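import Literature.NumberTheory.Automorphic.SLTwoTreeProjectiveActionIso             -- ★ (W1c)-A: `glVertexAct`, `glTreeIso`, `glVertexAct_eq_iff` (brings ★ `SLTwoTreeAsLatticeTree`, ★ `HermitianLatticeTreeDefs`)
import Literature.NumberTheory.Automorphic.HermitianLatticeTreeParent                -- ★ `latt_le_latt_iff`
import Literature.NumberTheory.Automorphic.FixedCosetsStableLattices                 -- ★ `span_range_transpose_eq_iff` (`latt g = latt g' ↔ g⁻¹ g' ∈ GL₂(𝒪)`)
import Literature.NumberTheory.Automorphic.HeckeTransversalGL                        -- ★ `IsIntegralMatrix`, `mem_glInt_of_isIntegralMatrix`, `isIntegralMatrix_of_mem_glInt`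
import Literature.NumberTheory.Automorphic.UnitaryGroupCongruenceIwahoriFactorisation  -- ★ `UnitaryGroup.coe_qsInvolution_apply` (brings ★ `UnitaryGroup.qsInvolution`)
import HarnessLib

/-!
# R90 · S6 «Ch. 14.1–14.5 stable TF» — card W11, FILE 1: THE `Θσ`-INVOLUTION ON THE TREE OF `GL₂(E_w)` («TREE IN TREE», rank one)
# (`Theorems/R90S6TwistedTreeInvolutionRankOne.lean`; DAG E1.4.4.3.2, the `G̃`-side count layer of the `η̂_j` clauses)

Cell `hodgecm-mathlib`, crux H413 (`stmt-HodgeConjecture-24833`), route of record `HCCMUnconditional`; programme R90-TF, section S6 (base `R90-C14`),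
seat K2Liu-p27 (g4) (cross-line hand); S6 dealer R90-C14-plan (g2) CARD W11 (R90 bus 2026-09-05T02:43:57Z, GO on FILE 1 02:48:50Z, HEADS v1 02:51:51Z).
Lane `--supports stmt-HodgeConjecture-24833 --as helper`; ONE definition (`thetaTreeIso`, the object exception granted like ★ `glTreeIso`) + theorems (the θ-frame
enters `GL₂(E)` only as the term `GeneralLinearGroup.mk'' _ (isUnit_det_theta σ h)`, no auxiliary definition); no instance, no notation, no named fact, no `sorry`.

THE OBJECT [Rogawski1990, §4.11 pp. 58–60, Lemma 11.5.3; Langlands 1980 §5 (the template «tree in tree»); Serre, *Trees* II.1].  `E` a discretely valued field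
(`ValuativeRel E`, `𝒪[E]` a DVR, uniformiser `ϖ`), `σ : E →+* E` an involution preserving the valuation (the conjugation of `E_w ∕ F_v`).  `X = latticeTree (RingHom.id E) ϖ J`,
`J = (0 1; −1 0)`, is the tree of `GL₂(E)` (★ `isTree_latticeTree_id_altJ`: vertices = the lattices `latt h` with `|det h| ∈ {1, |ϖ|}`, ONE representative per
homothety class; `GL₂(E)` acts through `PGL₂(E)` by ★ `glVertexAct`).  The quasi-split involution `Θ = Θσ : g ↦ w ᵗ(σg)⁻¹ w` (★ `UnitaryGroup.qsInvolution σ`,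
`Fix Θ = U(1,1) = U(σ, w)`, `w = (0 1; 1 0)`) acts on homothety classes of lattices by `[Λ] ↦ [Λ^♯]`, `Λ^♯` the `σ`-hermitian `w`-dual (★ W9-b at every rank:
`(h·𝒪²)^♯ = Θ(h)·𝒪²`).  AT RANK 2 THIS IS ELEMENTARY: by the adjugate identity `ᵗA⁻¹ = J A J⁻¹ ∕ det A` one has `Θ(h) = D·σ(h)·D·(σ det h)⁻¹` with
`D = J⁻¹ w = diag(−1, 1)`, so on the special representatives the involution is
  `θ̄ (latt h) = latt (D · σ(h))` — apply `σ` to the frame and negate the first ROW —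
which preserves `|det|`, hence the vertex type, with no rescaling.  This file builds `θ̄` as a GRAPH AUTOMORPHISM OF THE TREE and proves its basic laws.

WHAT IS PROVED (`hσv : ∀ x, |σ x| = |x|`, `hσσ : σ ∘ σ = id`):
* §1 frame algebra (theorems on the private frame `Matrix.GeneralLinearGroup.mk'' _ (isUnit_det_theta σ h) = D·σ(h)`): determinant valuation, specialness of the same type, frame-independence
  (`latt h = latt h′ ⇒ latt (Dσh) = latt (Dσh′)`, as `σ(GL₂(𝒪)) = GL₂(𝒪)`), involutivity `Dσ(Dσh) = h`, transport of inclusions and of the scaling `ϖ·`.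
* §2 **`thetaTreeIso hϖ σ hσv hσσ : X ≃g X`** (T.0), with (T.1) **`thetaTreeIso_apply_coe`**: `(θ̄ M).1 = latt (−σ h₀₀, −σ h₀₁; σ h₁₀, σ h₁₁)` for EVERY frame `h` of `M`;
  (T.2) **`isSelfDualLattice_thetaTreeIso_iff`** (type-preserving); (T.3) **`thetaTreeIso_thetaTreeIso`**, `thetaTreeIso_symm` (`θ̄² = id`).
SEQUEL (FILE 1b `R90S6TwistedTreeInvolutionFixedRankOne`): (T.5) the FIXED vertices of `θ̄` = the vertices of the `U(1,1)` tree `latticeTree σ ϖ w` (self-dual or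
`ϖ`-modular for the hermitian form `w`, «tree in tree»), and (T.4) the semiconjugation `θ̄ (g • M) = Θ(g) • θ̄ M` with ★ `glVertexAct` (so `τ_δ := glTreeIso δ ∘ θ̄` is the
twisted displacement map of ★ W9-c, `τ_δ² = (δ·Θδ)•`; FILE 2 counts via ★ W8-f).
HONEST LABEL: lattice∕tree bookkeeping for the count layer of E1.4.4.3.2, count-neutral until the η̂_j clauses consume it; proves no printed global statement, discharges no
citation; HC_CM is proved only modulo the 7 printed citations (2 remaining named inputs: hLiu418 = stmt-HodgeConjecture-24832, h413 = stmt-HodgeConjecture-24833) until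
rung 0 closes; REL ≠ ★ ≠ BUILT.

## References
* [Rogawski1990] J. D. Rogawski, *Automorphic Representations of Unitary Groups in Three Variables*, Ann. of Math. Stud. 123 (1990), §1.9 p. 8 (`Θ`), §4.11 Prop. 4.11.1
  pp. 58–60, §11.5 Lemma 11.5.3 p. 155.
* [Langlands1980AMS96] R. P. Langlands, *Base Change for GL(2)*, Ann. of Math. Stud. 96 (1980), §5 (counting on the tree, Galois action).
* [Serre1980Trees] J.-P. Serre, *Trees* (1980), Ch. II §1.1–§1.3.
* [Kottwitz1986BaseChangeUnits] R. Kottwitz, *Base change for unit elements of Hecke algebras*, Compositio Math. 60 (1986), §1 pp. 239–242.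
-/

set_option autoImplicit false
-- the mandated namespace repeats the single-problem summit's segment (`HodgeConjecture.HodgeConjecture`)
set_option linter.dupNamespace false

noncomputable section

open scoped ValuativeRel Matrix MatrixGroups
open Matrix ValuativeRel
open Literature.NumberTheory.Automorphic Literature.NumberTheory.Automorphic.HermitianLatticeTree

namespace Summit.HodgeConjecture.HodgeConjecture.R90.S6

variable {E : Type*} [Field E]

/-! ## §1 The frame `D·σ(h)` of the hermitian dual (private frame algebra) -/

section Frame

variable (σ : E →+* E)

/-- The determinant of the θ-frame `D·σ(h) = (−σ h₀₀, −σ h₀₁; σ h₁₀, σ h₁₁)` is `−σ(det h)`. [folklore] -/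
private theorem det_theta (h : GL (Fin 2) E) :
    Matrix.det !![-σ ((h : Matrix (Fin 2) (Fin 2) E) 0 0), -σ ((h : Matrix (Fin 2) (Fin 2) E) 0 1);
        σ ((h : Matrix (Fin 2) (Fin 2) E) 1 0), σ ((h : Matrix (Fin 2) (Fin 2) E) 1 1)] = -σ ((h : Matrix (Fin 2) (Fin 2) E).det) := by
  rw [Matrix.det_fin_two_of, Matrix.det_fin_two, map_sub, map_mul, map_mul]
  ring

/-- The θ-frame is invertible (this proof term is how the θ-frame enters `GL₂(E)`: `GeneralLinearGroup.mk'' _ (isUnit_det_theta σ h)`). [folklore] -/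
private theorem isUnit_det_theta (h : GL (Fin 2) E) :
    IsUnit (Matrix.det !![-σ ((h : Matrix (Fin 2) (Fin 2) E) 0 0), -σ ((h : Matrix (Fin 2) (Fin 2) E) 0 1);
        σ ((h : Matrix (Fin 2) (Fin 2) E) 1 0), σ ((h : Matrix (Fin 2) (Fin 2) E) 1 1)]) := by
  rw [det_theta]
  exact isUnit_iff_ne_zero.2 (neg_ne_zero.2 ((map_ne_zero σ).2 (h.isUnit.map Matrix.detMonoidHom).ne_zero))

/-- The matrix of the θ-frame as an element of `GL₂(E)`. [folklore] -/
private theorem coe_theta (h : GL (Fin 2) E) :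
    ((Matrix.GeneralLinearGroup.mk'' _ (isUnit_det_theta σ h) : GL (Fin 2) E) : Matrix (Fin 2) (Fin 2) E) =
      !![-σ ((h : Matrix (Fin 2) (Fin 2) E) 0 0), -σ ((h : Matrix (Fin 2) (Fin 2) E) 0 1);
        σ ((h : Matrix (Fin 2) (Fin 2) E) 1 0), σ ((h : Matrix (Fin 2) (Fin 2) E) 1 1)] := rfl

/-- The θ-frame is `D·σ(h)`, `D = diag(−1,1)`. [folklore] -/
private theorem theta_eq_mul_map (h : GL (Fin 2) E) :
    (!![-σ ((h : Matrix (Fin 2) (Fin 2) E) 0 0), -σ ((h : Matrix (Fin 2) (Fin 2) E) 0 1);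
        σ ((h : Matrix (Fin 2) (Fin 2) E) 1 0), σ ((h : Matrix (Fin 2) (Fin 2) E) 1 1)] : Matrix (Fin 2) (Fin 2) E) =
      !![-1, 0; 0, 1] * ((h : Matrix (Fin 2) (Fin 2) E)).map σ := by
  ext i j
  fin_cases i <;> fin_cases j <;> simp [Matrix.mul_apply, Fin.sum_univ_two]

/-- `D² = 1`. [folklore] -/
private theorem negRow_mul_negRow : (!![-1, 0; 0, 1] : Matrix (Fin 2) (Fin 2) E) * !![-1, 0; 0, 1] = 1 := by
  ext i j; fin_cases i <;> fin_cases j <;> simp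

/-- `σ(D) = D` (entries `0, ±1`). [folklore] -/
private theorem map_negRow : (!![-1, 0; 0, 1] : Matrix (Fin 2) (Fin 2) E).map σ = !![-1, 0; 0, 1] := by
  ext i j; fin_cases i <;> fin_cases j <;> simp

/-- The matrix of `σ g` is `σ` applied entrywise. [folklore] -/
private theorem coe_map (g : GL (Fin 2) E) :
    ((Matrix.GeneralLinearGroup.map σ g : GL (Fin 2) E) : Matrix (Fin 2) (Fin 2) E) = ((g : Matrix (Fin 2) (Fin 2) E)).map σ := rfl

/-- `Dσ(h·k) = Dσ(h)·σ(k)` in `GL₂(E)`. [folklore] -/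
private theorem theta_mul (h k : GL (Fin 2) E) :
    Matrix.GeneralLinearGroup.mk'' _ (isUnit_det_theta σ (h * k)) =
      Matrix.GeneralLinearGroup.mk'' _ (isUnit_det_theta σ h) * Matrix.GeneralLinearGroup.map σ k := by
  refine Units.ext ?_
  change (!![_, _; _, _] : Matrix (Fin 2) (Fin 2) E) = (!![_, _; _, _] : Matrix (Fin 2) (Fin 2) E) * _
  rw [theta_eq_mul_map, theta_eq_mul_map, coe_map, Units.val_mul, Matrix.map_mul, Matrix.mul_assoc]

/-- `Dσ(Dσ(h)) = h` for an involution `σ` (`σ(D) = D`, `D² = 1`). [folklore] -/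
private theorem theta_theta (hσσ : ∀ x, σ (σ x) = x) (h : GL (Fin 2) E) :
    Matrix.GeneralLinearGroup.mk'' _ (isUnit_det_theta σ (Matrix.GeneralLinearGroup.mk'' _ (isUnit_det_theta σ h))) = h := by
  refine Units.ext ?_
  change (!![_, _; _, _] : Matrix (Fin 2) (Fin 2) E) = _
  rw [theta_eq_mul_map]
  change !![-1, 0; 0, 1] * (!![_, _; _, _] : Matrix (Fin 2) (Fin 2) E).map σ = _
  have hmm : (((h : Matrix (Fin 2) (Fin 2) E)).map σ).map σ = (h : Matrix (Fin 2) (Fin 2) E) := by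
    ext i j; exact hσσ _
  rw [theta_eq_mul_map, Matrix.map_mul, map_negRow, hmm, ← Matrix.mul_assoc, negRow_mul_negRow, Matrix.one_mul]

/-- `det (c • h)` is a unit for `c ≠ 0`. [folklore] -/
private theorem isUnit_det_smul {c : E} (hc : c ≠ 0) (h : GL (Fin 2) E) : IsUnit (c • (h : Matrix (Fin 2) (Fin 2) E)).det := by
  rw [Matrix.det_smul, Fintype.card_fin]
  exact (isUnit_iff_ne_zero.2 (pow_ne_zero _ hc)).mul (h.isUnit.map Matrix.detMonoidHom)

variable [ValuativeRel E]

/-- The θ-frame of `c • h` spans `σ(c) · latt (Dσh)`. [folklore] -/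
private theorem latt_theta_smul {c : E} (hc : c ≠ 0) (h : GL (Fin 2) E) :
    latt ((Matrix.GeneralLinearGroup.mk'' _ (isUnit_det_theta σ (Matrix.GeneralLinearGroup.mk'' _ (isUnit_det_smul hc h))) : GL (Fin 2) E) :
        Matrix (Fin 2) (Fin 2) E) =
      scaleLattice (σ c) (latt ((Matrix.GeneralLinearGroup.mk'' _ (isUnit_det_theta σ h) : GL (Fin 2) E) : Matrix (Fin 2) (Fin 2) E)) := by
  rw [scaleLattice_latt]
  congr 1
  change (!![_, _; _, _] : Matrix (Fin 2) (Fin 2) E) = σ c • (!![_, _; _, _] : Matrix (Fin 2) (Fin 2) E)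
  have hv : ∀ i j, ((Matrix.GeneralLinearGroup.mk'' _ (isUnit_det_smul hc h) : GL (Fin 2) E) : Matrix (Fin 2) (Fin 2) E) i j =
      c * (h : Matrix (Fin 2) (Fin 2) E) i j := fun i j => rfl
  ext i j
  fin_cases i <;> fin_cases j <;> simp [hv, map_mul, mul_neg]

variable (hσv : ∀ x : E, valuation E (σ x) = valuation E x)
include hσv

/-- `|det (Dσ(h))| = |det h|`. [folklore] -/
private theorem valuation_det_theta (h : GL (Fin 2) E) :
    valuation E ((Matrix.GeneralLinearGroup.mk'' _ (isUnit_det_theta σ h) : GL (Fin 2) E) : Matrix (Fin 2) (Fin 2) E).det =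
      valuation E (h : Matrix (Fin 2) (Fin 2) E).det := by
  change valuation E (Matrix.det !![_, _; _, _]) = _
  rw [det_theta, Valuation.map_neg, hσv]

/-- `σ` (entrywise) preserves integrality of matrices. [folklore] -/
private theorem isIntegralMatrix_map_iff (A : Matrix (Fin 2) (Fin 2) E) : IsIntegralMatrix (A.map σ) ↔ IsIntegralMatrix A := by
  simp only [IsIntegralMatrix, Matrix.map_apply, Valuation.mem_integer_iff, hσv]

/-- `σ(GL₂(𝒪)) ⊆ GL₂(𝒪)`. [folklore] -/
private theorem map_mem_glInt {k : GL (Fin 2) E} (hk : k ∈ glInt 2 E) : Matrix.GeneralLinearGroup.map σ k ∈ glInt 2 E := by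
  rw [mem_glInt_iff] at hk ⊢
  refine ⟨fun i j => ?_, fun i j => ?_⟩
  · exact ((isIntegralMatrix_map_iff σ hσv _).2 (fun i j => hk.1 i j)) i j
  · rw [← map_inv]
    exact ((isIntegralMatrix_map_iff σ hσv _).2 (fun i j => hk.2 i j)) i j

/-- FRAME-INDEPENDENCE: `latt h = latt h′ ⇒ latt (Dσh) = latt (Dσh′)`. [cite: Serre1980Trees, Ch. II §1.1] -/
private theorem latt_theta_eq_of_latt_eq {h h' : GL (Fin 2) E}
    (hh : latt (h : Matrix (Fin 2) (Fin 2) E) = latt (h' : Matrix (Fin 2) (Fin 2) E)) :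
    latt ((Matrix.GeneralLinearGroup.mk'' _ (isUnit_det_theta σ h) : GL (Fin 2) E) : Matrix (Fin 2) (Fin 2) E) =
      latt ((Matrix.GeneralLinearGroup.mk'' _ (isUnit_det_theta σ h') : GL (Fin 2) E) : Matrix (Fin 2) (Fin 2) E) := by
  have hk : h⁻¹ * h' ∈ glInt 2 E := (span_range_transpose_eq_iff h h').1 hh
  have e : Matrix.GeneralLinearGroup.mk'' _ (isUnit_det_theta σ h') =
      Matrix.GeneralLinearGroup.mk'' _ (isUnit_det_theta σ h) * Matrix.GeneralLinearGroup.map σ (h⁻¹ * h') := by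
    rw [← theta_mul]; congr 1; rw [mul_inv_cancel_left]
  rw [e, latt_mul_of_mem_glInt _ _ (map_mem_glInt σ hσv hk)]

/-- Inclusions are transported: `latt (Dσh′) ≤ latt (Dσh) ↔ latt h′ ≤ latt h`. [cite: Serre1980Trees, Ch. II §1.1] -/
private theorem latt_theta_le_iff (h h' : GL (Fin 2) E) :
    latt ((Matrix.GeneralLinearGroup.mk'' _ (isUnit_det_theta σ h') : GL (Fin 2) E) : Matrix (Fin 2) (Fin 2) E) ≤
        latt ((Matrix.GeneralLinearGroup.mk'' _ (isUnit_det_theta σ h) : GL (Fin 2) E) : Matrix (Fin 2) (Fin 2) E) ↔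
      latt (h' : Matrix (Fin 2) (Fin 2) E) ≤ latt (h : Matrix (Fin 2) (Fin 2) E) := by
  have e : (Matrix.GeneralLinearGroup.mk'' _ (isUnit_det_theta σ h))⁻¹ * Matrix.GeneralLinearGroup.mk'' _ (isUnit_det_theta σ h') =
      Matrix.GeneralLinearGroup.map σ (h⁻¹ * h') := by
    rw [inv_mul_eq_iff_eq_mul, ← theta_mul, mul_inv_cancel_left]
  rw [latt_le_latt_iff, latt_le_latt_iff, e, coe_map]
  exact isIntegralMatrix_map_iff σ hσv _

/-- Scaling is transported: `latt (Dσ(c • h)) = c · latt (Dσh)` for `c ≠ 0` (`σc ∈ 𝒪^× c`). [cite: Serre1980Trees, Ch. II §1.1] -/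
private theorem latt_theta_smul_eq_scaleLattice {c : E} (hc : c ≠ 0) (h : GL (Fin 2) E) :
    latt ((Matrix.GeneralLinearGroup.mk'' _ (isUnit_det_theta σ (Matrix.GeneralLinearGroup.mk'' _ (isUnit_det_smul hc h))) : GL (Fin 2) E) : Matrix (Fin 2) (Fin 2) E) =
      scaleLattice c (latt ((Matrix.GeneralLinearGroup.mk'' _ (isUnit_det_theta σ h) : GL (Fin 2) E) : Matrix (Fin 2) (Fin 2) E)) := by
  have hu : valuation E (σ c * c⁻¹) = 1 := by
    rw [map_mul, map_inv₀, hσv, mul_inv_cancel₀ ((Valuation.ne_zero_iff _).2 hc)]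
  have e : c * (σ c * c⁻¹) = σ c := by rw [mul_comm (σ c) c⁻¹, ← mul_assoc, mul_inv_cancel₀ hc, one_mul]
  rw [latt_theta_smul σ hc, ← e, ← scaleLattice_scaleLattice, scaleLattice_latt_eq_of_valuation_eq_one hu]

omit hσv in
/-- `c · latt h = latt (c • h)` with `c • h` as an element of `GL₂(E)`. [cite: Serre1980Trees, Ch. II §1.1] -/
private theorem scaleLattice_latt_eq_latt_mk'' {c : E} (hc : c ≠ 0) (h : GL (Fin 2) E) :
    scaleLattice c (latt (h : Matrix (Fin 2) (Fin 2) E)) =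
      latt ((Matrix.GeneralLinearGroup.mk'' _ (isUnit_det_smul hc h) : GL (Fin 2) E) : Matrix (Fin 2) (Fin 2) E) :=
  scaleLattice_latt c _

/-- Specialness of the θ-frame, same type. [cite: Serre1980Trees, Ch. II §1.1 Theorem 1] -/
private theorem isSpecialLattice_latt_theta {ϖ : E} (h0 : ϖ ≠ 0) (h : GL (Fin 2) E) {e : ℤ} (he : e = 0 ∨ e = 1)
    (hdet : valuation E (h : Matrix (Fin 2) (Fin 2) E).det = valuation E (ϖ ^ e)) :
    IsSpecialLattice (RingHom.id E) ϖ !![(0 : E), 1; -1, 0] (latt ((Matrix.GeneralLinearGroup.mk'' _ (isUnit_det_theta σ h) : GL (Fin 2) E) : Matrix (Fin 2) (Fin 2) E)) :=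
  isSpecialLattice_latt_of_valuation_det h0 _ he ((valuation_det_theta σ hσv h).trans hdet)

/-- Self-duality is transported (forward). [cite: Serre1980Trees, Ch. II §1.2] -/
private theorem isSelfDualLattice_latt_theta {h : GL (Fin 2) E}
    (hh : IsSelfDualLattice (RingHom.id E) !![(0 : E), 1; -1, 0] (latt (h : Matrix (Fin 2) (Fin 2) E))) :
    IsSelfDualLattice (RingHom.id E) !![(0 : E), 1; -1, 0] (latt ((Matrix.GeneralLinearGroup.mk'' _ (isUnit_det_theta σ h) : GL (Fin 2) E) : Matrix (Fin 2) (Fin 2) E)) := by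
  obtain ⟨g, hg, hdet⟩ := (isSelfDualLattice_id_altJ_iff _).1 hh
  exact (isSelfDualLattice_id_altJ_iff _).2 ⟨Matrix.GeneralLinearGroup.mk'' _ (isUnit_det_theta σ g), latt_theta_eq_of_latt_eq σ hσv hg, by rw [valuation_det_theta σ hσv, hdet]⟩

/-- `ϖ`-modularity is transported (forward). [cite: Serre1980Trees, Ch. II §1.2] -/
private theorem isModularLattice_latt_theta {ϖ : E} (h0 : ϖ ≠ 0) {h : GL (Fin 2) E}
    (hh : IsModularLattice (RingHom.id E) ϖ !![(0 : E), 1; -1, 0] (latt (h : Matrix (Fin 2) (Fin 2) E))) :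
    IsModularLattice (RingHom.id E) ϖ !![(0 : E), 1; -1, 0] (latt ((Matrix.GeneralLinearGroup.mk'' _ (isUnit_det_theta σ h) : GL (Fin 2) E) : Matrix (Fin 2) (Fin 2) E)) := by
  obtain ⟨g, hg, hdet⟩ := (isModularLattice_id_altJ_iff h0 _).1 hh
  exact (isModularLattice_id_altJ_iff h0 _).2 ⟨Matrix.GeneralLinearGroup.mk'' _ (isUnit_det_theta σ g), latt_theta_eq_of_latt_eq σ hσv hg, by rw [valuation_det_theta σ hσv, hdet]⟩

end Frame

/-! ## §2 The involution `θ̄ : [Λ] ↦ [Λ^♯]` as a graph automorphism of the tree of `GL₂(E)` -/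

section Tree

variable [ValuativeRel E] {ϖ : E} (hϖ : IsUniformizingElement ϖ) (σ : E →+* E)
  (hσv : ∀ x : E, valuation E (σ x) = valuation E x) (hσσ : ∀ x : E, σ (σ x) = x)

include hσv in
/-- The chosen frame of a vertex spans it. [cite: Serre1980Trees, Ch. II §1.1 Theorem 1] -/
private theorem latt_choose_eq {M : Submodule 𝒪[E] (Fin 2 → E)} (h0 : ϖ ≠ 0) (hM : IsSpecialLattice (RingHom.id E) ϖ !![(0 : E), 1; -1, 0] M)
    {h : GL (Fin 2) E} (hh : M = latt (h : Matrix (Fin 2) (Fin 2) E)) :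
    latt ((Matrix.GeneralLinearGroup.mk'' _ (isUnit_det_theta σ (Classical.choose (exists_latt_eq_of_isSpecialLattice h0 hM))) : GL (Fin 2) E) : Matrix (Fin 2) (Fin 2) E) =
      latt ((Matrix.GeneralLinearGroup.mk'' _ (isUnit_det_theta σ h) : GL (Fin 2) E) : Matrix (Fin 2) (Fin 2) E) :=
  latt_theta_eq_of_latt_eq σ hσv
    ((((Classical.choose_spec (exists_latt_eq_of_isSpecialLattice h0 hM)).elim fun _ he => he.2.1).symm).trans hh)

include hσv in
/-- The θ-image of the chosen frame of a vertex is a vertex. [cite: Serre1980Trees, Ch. II §1.1 Theorem 1] -/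
private theorem isSpecialLattice_latt_theta_choose {M : Submodule 𝒪[E] (Fin 2 → E)} (h0 : ϖ ≠ 0)
    (hM : IsSpecialLattice (RingHom.id E) ϖ !![(0 : E), 1; -1, 0] M) :
    IsSpecialLattice (RingHom.id E) ϖ !![(0 : E), 1; -1, 0]
      (latt ((Matrix.GeneralLinearGroup.mk'' _ (isUnit_det_theta σ (Classical.choose (exists_latt_eq_of_isSpecialLattice h0 hM))) : GL (Fin 2) E) : Matrix (Fin 2) (Fin 2) E)) :=
  (Classical.choose_spec (exists_latt_eq_of_isSpecialLattice h0 hM)).elim fun _ he =>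
    isSpecialLattice_latt_theta σ hσv h0 _ he.1 he.2.2

include hσv hσσ in
/-- Involutivity on vertices: the θ-image of the θ-image of `M` is `M`. [cite: Rogawski1990, §1.9 p. 8] -/
private theorem latt_theta_choose_theta_choose (h0 : ϖ ≠ 0)
    (M : {M : Submodule 𝒪[E] (Fin 2 → E) // IsSpecialLattice (RingHom.id E) ϖ !![(0 : E), 1; -1, 0] M}) :
    latt ((Matrix.GeneralLinearGroup.mk'' _ (isUnit_det_theta σ (Classical.choose (exists_latt_eq_of_isSpecialLattice h0
        (isSpecialLattice_latt_theta_choose σ hσv h0 M.2)))) : GL (Fin 2) E) : Matrix (Fin 2) (Fin 2) E) = M.1 := by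
  rw [latt_choose_eq σ hσv h0 (isSpecialLattice_latt_theta_choose σ hσv h0 M.2) rfl, theta_theta σ hσσ]
  exact ((Classical.choose_spec (exists_latt_eq_of_isSpecialLattice h0 M.2)).elim fun _ he => he.2.1).symm

/-- An involutive vertex map that preserves adjacency reflects it. [folklore] -/
private theorem adj_iff_of_involutive {V : Type*} {G : SimpleGraph V} {f : V → V} (hf : ∀ x, f (f x) = x)
    (hadj : ∀ {a b : V}, G.Adj a b → G.Adj (f a) (f b)) {a b : V} : G.Adj (f a) (f b) ↔ G.Adj a b :=
  ⟨fun h => by simpa only [hf] using hadj h, hadj⟩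

include hσv hσσ in
/-- Adjacency is transported by `θ̄` (types kept, inclusions and the scaling `ϖ·` transported). [cite: Serre1980Trees, Ch. II §1.1–§1.3] -/
private theorem latticeTree_adj_theta (h0 : ϖ ≠ 0)
    {M N : {M : Submodule 𝒪[E] (Fin 2 → E) // IsSpecialLattice (RingHom.id E) ϖ !![(0 : E), 1; -1, 0] M}}
    (hMN : (latticeTree (RingHom.id E) ϖ !![(0 : E), 1; -1, 0]).Adj M N) :
    (latticeTree (RingHom.id E) ϖ !![(0 : E), 1; -1, 0]).Adj
      ⟨latt ((Matrix.GeneralLinearGroup.mk'' _ (isUnit_det_theta σ (Classical.choose (exists_latt_eq_of_isSpecialLattice h0 M.2))) : GL (Fin 2) E) : Matrix (Fin 2) (Fin 2) E),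
        isSpecialLattice_latt_theta_choose σ hσv h0 M.2⟩
      ⟨latt ((Matrix.GeneralLinearGroup.mk'' _ (isUnit_det_theta σ (Classical.choose (exists_latt_eq_of_isSpecialLattice h0 N.2))) : GL (Fin 2) E) : Matrix (Fin 2) (Fin 2) E),
        isSpecialLattice_latt_theta_choose σ hσv h0 N.2⟩ := by
  rw [latticeTree_adj_iff] at hMN ⊢
  dsimp only
  obtain ⟨hne, hcases⟩ := hMN
  refine ⟨fun heq => hne (Subtype.ext ?_), ?_⟩
  · -- injectivity through involutivity
    have h1 := congrArg Subtype.val heq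
    dsimp only at h1
    rw [← latt_theta_choose_theta_choose σ hσv hσσ h0 M, ← latt_theta_choose_theta_choose σ hσv hσσ h0 N]
    exact latt_theta_eq_of_latt_eq σ hσv
      ((((Classical.choose_spec (exists_latt_eq_of_isSpecialLattice h0 (isSpecialLattice_latt_theta_choose σ hσv h0 M.2))).elim
          fun _ he => he.2.1).symm.trans (h1.trans
        ((Classical.choose_spec (exists_latt_eq_of_isSpecialLattice h0 (isSpecialLattice_latt_theta_choose σ hσv h0 N.2))).elim
          fun _ he => he.2.1))))
  · rcases hcases with ⟨hM, hN, h1, h2⟩ | ⟨hN, hM, h1, h2⟩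
    · obtain ⟨g, hMg, -⟩ := (isSelfDualLattice_id_altJ_iff _).1 hM
      obtain ⟨g', hNg', -⟩ := (isModularLattice_id_altJ_iff h0 _).1 hN
      refine Or.inl ⟨?_, ?_, ?_, ?_⟩
      · rw [latt_choose_eq σ hσv h0 M.2 hMg]; rw [hMg] at hM; exact isSelfDualLattice_latt_theta σ hσv hM
      · rw [latt_choose_eq σ hσv h0 N.2 hNg']; rw [hNg'] at hN; exact isModularLattice_latt_theta σ hσv h0 hN
      · rw [latt_choose_eq σ hσv h0 M.2 hMg, latt_choose_eq σ hσv h0 N.2 hNg', ← latt_theta_smul_eq_scaleLattice σ hσv h0,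
          latt_theta_le_iff σ hσv, ← scaleLattice_latt_eq_latt_mk'' h0, ← hMg, ← hNg']
        exact h1
      · rw [latt_choose_eq σ hσv h0 M.2 hMg, latt_choose_eq σ hσv h0 N.2 hNg', latt_theta_le_iff σ hσv, ← hMg, ← hNg']
        exact h2
    · obtain ⟨g, hNg, -⟩ := (isSelfDualLattice_id_altJ_iff _).1 hN
      obtain ⟨g', hMg', -⟩ := (isModularLattice_id_altJ_iff h0 _).1 hM
      refine Or.inr ⟨?_, ?_, ?_, ?_⟩
      · rw [latt_choose_eq σ hσv h0 N.2 hNg]; rw [hNg] at hN; exact isSelfDualLattice_latt_theta σ hσv hN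
      · rw [latt_choose_eq σ hσv h0 M.2 hMg']; rw [hMg'] at hM; exact isModularLattice_latt_theta σ hσv h0 hM
      · rw [latt_choose_eq σ hσv h0 N.2 hNg, latt_choose_eq σ hσv h0 M.2 hMg', ← latt_theta_smul_eq_scaleLattice σ hσv h0,
          latt_theta_le_iff σ hσv, ← scaleLattice_latt_eq_latt_mk'' h0, ← hNg, ← hMg']
        exact h1
      · rw [latt_choose_eq σ hσv h0 N.2 hNg, latt_choose_eq σ hσv h0 M.2 hMg', latt_theta_le_iff σ hσv, ← hNg, ← hMg']
        exact h2

/-- **(T.0) THE INVOLUTION `θ̄` ON THE TREE OF `GL₂(E)` AS A GRAPH AUTOMORPHISM**: on the special representative `latt h` of a homothety class,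
`θ̄ (latt h) = latt (D·σ(h))` (`σ` on the frame, first row negated) — the class of the `σ`-hermitian `w`-dual `Θ(h)·𝒪²` (★ W9-b; `Θ(h) = Dσ(h)D(σ det h)⁻¹`).
Type-preserving, involutive, adjacency-preserving; for an involution `σ` preserving `|·|` (`E ∕ E^σ` unramified or not). [cite: Rogawski1990, §4.11 pp. 58–60]
[cite: Langlands1980AMS96, §5] [cite: Serre1980Trees, Ch. II §1.1–§1.3] -/
def thetaTreeIso : latticeTree (RingHom.id E) ϖ !![(0 : E), 1; -1, 0] ≃g latticeTree (RingHom.id E) ϖ !![(0 : E), 1; -1, 0] where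
  toFun M := ⟨latt ((Matrix.GeneralLinearGroup.mk'' _ (isUnit_det_theta σ (Classical.choose (exists_latt_eq_of_isSpecialLattice hϖ.ne_zero M.2))) : GL (Fin 2) E) : Matrix (Fin 2) (Fin 2) E),
    isSpecialLattice_latt_theta_choose σ hσv hϖ.ne_zero M.2⟩
  invFun M := ⟨latt ((Matrix.GeneralLinearGroup.mk'' _ (isUnit_det_theta σ (Classical.choose (exists_latt_eq_of_isSpecialLattice hϖ.ne_zero M.2))) : GL (Fin 2) E) : Matrix (Fin 2) (Fin 2) E),
    isSpecialLattice_latt_theta_choose σ hσv hϖ.ne_zero M.2⟩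
  left_inv M := Subtype.ext (latt_theta_choose_theta_choose σ hσv hσσ hϖ.ne_zero M)
  right_inv M := Subtype.ext (latt_theta_choose_theta_choose σ hσv hσσ hϖ.ne_zero M)
  map_rel_iff' := adj_iff_of_involutive
    (f := fun M => ⟨latt ((Matrix.GeneralLinearGroup.mk'' _ (isUnit_det_theta σ (Classical.choose (exists_latt_eq_of_isSpecialLattice hϖ.ne_zero M.2))) : GL (Fin 2) E) :
      Matrix (Fin 2) (Fin 2) E), isSpecialLattice_latt_theta_choose σ hσv hϖ.ne_zero M.2⟩)
    (fun M => Subtype.ext (latt_theta_choose_theta_choose σ hσv hσσ hϖ.ne_zero M))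
    (fun h => latticeTree_adj_theta σ hσv hσσ hϖ.ne_zero h)

/-- **(T.1) `θ̄` ON FRAMES**: for EVERY frame `h` of the vertex `M` (`M = latt h`), `θ̄ M = latt (−σ h₀₀, −σ h₀₁; σ h₁₀, σ h₁₁)` — the lattice spanned by
`D·σ(h)`, independent of the frame (`σ(GL₂(𝒪)) = GL₂(𝒪)`). [cite: Rogawski1990, §1.9 p. 8] [cite: Serre1980Trees, Ch. II §1.1] -/
theorem thetaTreeIso_apply_coe (M : {M : Submodule 𝒪[E] (Fin 2 → E) // IsSpecialLattice (RingHom.id E) ϖ !![(0 : E), 1; -1, 0] M})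
    {h : GL (Fin 2) E} (hM : M.1 = latt (h : Matrix (Fin 2) (Fin 2) E)) :
    (thetaTreeIso hϖ σ hσv hσσ M).1 =
      latt !![-σ ((h : Matrix (Fin 2) (Fin 2) E) 0 0), -σ ((h : Matrix (Fin 2) (Fin 2) E) 0 1);
        σ ((h : Matrix (Fin 2) (Fin 2) E) 1 0), σ ((h : Matrix (Fin 2) (Fin 2) E) 1 1)] := by
  exact latt_choose_eq σ hσv hϖ.ne_zero M.2 hM

/-- **(T.3) `θ̄` IS AN INVOLUTION**: `θ̄ (θ̄ M) = M` (`σσ = id`, `D² = 1`, `σ(D) = D`). [cite: Rogawski1990, §1.9 p. 8] -/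
theorem thetaTreeIso_thetaTreeIso (M : {M : Submodule 𝒪[E] (Fin 2 → E) // IsSpecialLattice (RingHom.id E) ϖ !![(0 : E), 1; -1, 0] M}) :
    thetaTreeIso hϖ σ hσv hσσ (thetaTreeIso hϖ σ hσv hσσ M) = M :=
  Subtype.ext (latt_theta_choose_theta_choose σ hσv hσσ hϖ.ne_zero M)

/-- `θ̄` is its own inverse as a graph isomorphism. [cite: Rogawski1990, §1.9 p. 8] -/
theorem thetaTreeIso_symm : (thetaTreeIso hϖ σ hσv hσσ).symm = thetaTreeIso hϖ σ hσv hσσ := rfl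

/-- **(T.2) `θ̄` PRESERVES THE VERTEX TYPE**: `θ̄ M` is self-dual (an even vertex of Serre's tree, `|det| = 1`) iff `M` is. [cite: Serre1980Trees, Ch. II §1.2] -/
theorem isSelfDualLattice_thetaTreeIso_iff (M : {M : Submodule 𝒪[E] (Fin 2 → E) // IsSpecialLattice (RingHom.id E) ϖ !![(0 : E), 1; -1, 0] M}) :
    IsSelfDualLattice (RingHom.id E) !![(0 : E), 1; -1, 0] (thetaTreeIso hϖ σ hσv hσσ M).1 ↔
      IsSelfDualLattice (RingHom.id E) !![(0 : E), 1; -1, 0] M.1 := by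
  constructor
  · intro h
    have h2 : IsSelfDualLattice (RingHom.id E) !![(0 : E), 1; -1, 0] (thetaTreeIso hϖ σ hσv hσσ (thetaTreeIso hϖ σ hσv hσσ M)).1 := by
      obtain ⟨g, hg, hdet⟩ := (isSelfDualLattice_id_altJ_iff _).1 h
      rw [thetaTreeIso_apply_coe hϖ σ hσv hσσ _ hg, ← coe_theta]
      exact isSelfDualLattice_latt_theta σ hσv ((isSelfDualLattice_id_altJ_iff _).2 ⟨g, rfl, hdet⟩)
    rwa [thetaTreeIso_thetaTreeIso] at h2
  · intro h
    obtain ⟨g, hg, hdet⟩ := (isSelfDualLattice_id_altJ_iff _).1 h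
    rw [thetaTreeIso_apply_coe hϖ σ hσv hσσ _ hg, ← coe_theta]
    exact isSelfDualLattice_latt_theta σ hσv ((isSelfDualLattice_id_altJ_iff _).2 ⟨g, rfl, hdet⟩)

end Tree


end Summit.HodgeConjecture.HodgeConjecture.R90.S6

end
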